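import Summits.CriticalPhenomena.PercolationContinuityZ3.Theorems.PercNearOneGluingNoHeavyLowerTailSahiE4UnionRowFacts
import Summits.CriticalPhenomena.PercolationContinuityZ3.Theorems.PercNearOneGluingNoHeavyLowerTailSahiE4UnionChainBlockMeasure
import Mathlib.Tactic.LinearCombination
import HarnessLib

/-!
# `NoHeavyLowerTail` (crux stmt-CriticalPhenomena-4575), Sahi programme P4, ORDER 4: `E₄ ≥ 0` is preserved when an independent CHAIN block is
# OR-ed into three of four members — LATTICE level (all Harris rows discharged)

Support file (cell `prim-l12`, seat P4, generation 35; `--supports stmt-CriticalPhenomena-4575`).  No definitions, no named facts, no sorries;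
standard axioms.  `γ` a finite preorder with a probability weight `μ` Sahi-positive of order 2 (positively associated; [Sahi2008, §2]),
`a : Fin 4 → γ → [0,1]` monotone; `β` ANY finite type with a probability weight `ν` and `b : Fin 4 → β → [0,1]` multiplicatively nested
(`b_0b_1 = b_1`, `b_0b_2 = b_2`, `b_1b_2 = b_2`; for events `B_2 ⊆ B_1 ⊆ B_0`) with `b_3 = 0` — nothing else is assumed about the block; `u_i = a_i ⊕ b_i`
on `γ × β`.  THEOREM `sahiE_four_orChain_nonneg_of_sahiPositive_two`: if `E₃(a_1,a_2,a_3) ≥ 0`, the order-3 product rows `E₃(a_0a_1,a_2,a_3)`,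
`E₃(a_0a_2,a_1,a_3)`, `E₃(a_1a_2,a_0,a_3)`, `E₃(a_0a_3,a_1,a_2) ≥ 0` and `E₄(a) ≥ 0` (instances of Sahi's `C₃`, `C₄` on `γ` [Sahi2008, eq. (7);
LiebSahi2021, Def. 3.1]), then `E₄^{μ⊗ν}(u) ≥ 0`.  Proof: `…ChainBlockMeasure.sahiE_four_orChain_nonneg` with the Harris rows from
`SahiE4UnionHold.rowH_…`.  In the H₄⁺-closure programme (seat memos of generations 34–35) this is the three-member step for totally ordered
blocks; the general three-member step (arbitrary positively associated block) is open.  HONEST FRAMING: nothing here is Sahi's conjecture `C₄`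
itself. [this work]
-/

noncomputable section

namespace Summit.CriticalPhenomena.PercolationContinuityZ3.Theorems.SahiE4UnionChainBlock

open Finset Function Literature.Combinatorics.Sahi2008
open Summit.CriticalPhenomena.PercolationContinuityZ3.Theorems.SahiE4UnionHold

variable {γ β : Type*} [Fintype γ] [Fintype β] [Preorder γ]

/-- **Order-4 OR step, chain block into three members, lattice level.**  See the module docstring. [this work] -/
theorem sahiE_four_orChain_nonneg_of_sahiPositive_two (μ : γ → ℝ) (ν : β → ℝ)
    (hμ0 : ∀ t, 0 ≤ μ t) (hμ1 : ∑ t, μ t = 1) (hν0 : ∀ t, 0 ≤ ν t) (hν1 : ∑ t, ν t = 1) (hμ2 : SahiPositive μ 2)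
    (a : Fin 4 → γ → ℝ) (b : Fin 4 → β → ℝ) (ha0 : ∀ i t, 0 ≤ a i t) (ha1 : ∀ i t, a i t ≤ 1) (ham : ∀ i, Monotone (a i))
    (hb0 : ∀ i t, 0 ≤ b i t) (hb1 : ∀ i t, b i t ≤ 1) (hbz3 : ∀ t, b 3 t = 0)
    (hb01 : ∀ t, b 0 t * b 1 t = b 1 t) (hb02 : ∀ t, b 0 t * b 2 t = b 2 t) (hb12 : ∀ t, b 1 t * b 2 t = b 2 t)
    (he123 : 0 ≤ sahiE μ 3 ![a 1, a 2, a 3]) (he4 : 0 ≤ sahiE μ 4 a)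
    (hP01 : 0 ≤ sahiE μ 3 ![a 0 * a 1, a 2, a 3]) (hP02 : 0 ≤ sahiE μ 3 ![a 0 * a 2, a 1, a 3])
    (hP12 : 0 ≤ sahiE μ 3 ![a 1 * a 2, a 0, a 3]) (hP03 : 0 ≤ sahiE μ 3 ![a 0 * a 3, a 1, a 2]) :
    0 ≤ sahiE (fun p : γ × β => μ p.1 * ν p.2) 4 (fun (i : Fin 4) (p : γ × β) => a i p.1 + b i p.2 - a i p.1 * b i p.2) :=
  sahiE_four_orChain_nonneg μ ν hμ0 hμ1 hν0 hν1 a b ha0 ha1 hb0 hb1 hbz3 hb01 hb02 hb12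
    (rowH_2_3 μ hμ2 a ha0 ham) (rowH_2_13 μ hμ2 a ha0 ham) (rowH_2_013 μ hμ2 a ha0 ham) (rowH_12_3 μ hμ2 a ha0 ham)
    (rowH_012_3 μ hμ2 a ha0 ham) he123 he4 hP01 hP02 hP12 hP03

end Summit.CriticalPhenomena.PercolationContinuityZ3.Theorems.SahiE4UnionChainBlock

end
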